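import Literature.Analysis.FunctionSpaces.Minlos
import Literature.Analysis.FunctionSpaces.MinlosBorelProofs
import Literature.Analysis.FunctionSpaces.NuclearSpaceSchwartzProofs
import Literature.Analysis.FunctionSpaces.NuclearSpaceSchwartzSeparableProofs
import HarnessLib

/-!
# Minlos' theorem for Schwartz space (`Literature.Analysis.FunctionSpaces.schwartz_minlos`): proof

Discharge of the last named fact of `Literature/Analysis/FunctionSpaces/Minlos.lean`,
`Literature.Analysis.FunctionSpaces.schwartz_minlos`: Minlos' theorem for Borel probability measures on
`FieldConfig E = 𝒮'(E)`, `E` a finite-dimensional real normed space — every characteristic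
functional on `𝓢(E, ℝ)` is the generating functional of a unique Borel probability measure on
the weak-* dual.

It is the tree's `Literature.Analysis.FunctionSpaces.minlos_borel_holds` (`MinlosBorelProofs`: Minlos' theorem for Borel
measures on the dual of a separable Fréchet nuclear space — Bochner, Kolmogorov, the
Minlos–Sazonov estimate, and Borel = cylinder) for `V = 𝓢(E, ℝ)`, which is locally convex and
first countable (Mathlib), nuclear (`Literature.Analysis.FunctionSpaces.nuclearSpace_schwartzMap_holds`,
`NuclearSpaceSchwartzProofs`) and separable (`Literature.Analysis.FunctionSpaces.separableSpace_schwartzMap_holds`,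
`NuclearSpaceSchwartzSeparableProofs`), transported along the `rfl` bridges
`genFunctionalOf_eq_genFunctional` and `isCharacteristicFunctional_iff` of `Minlos.lean`. The same
statement in the vocabulary of `OSAxioms` (`Literature.MathematicalPhysics.QuantumFieldTheory.bochner_minlos`,
constructive-qft.S08) is discharged in
`Literature/MathematicalPhysics/QuantumFieldTheory/OSAxiomsProofs.lean`.

## References

* R. A. Minlos, *Generalized random processes and their extension to a measure*, Trudy Moskov.
  Mat. Obšč. 8 (1959), 497–518. [Minlos1959]
* I. M. Gel'fand, N. Ya. Vilenkin, *Generalized Functions IV* (1964), Ch. IV §4.2 Thm 2.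
  [GelfandVilenkinIV1964]
* Y. Yamasaki, *Measures on infinite dimensional spaces*, World Scientific (1985), Part A §20,
  Thm 20.1 (a). [Yamasaki1985]
-/

open scoped SchwartzMap
open MeasureTheory TopologicalSpace

namespace Literature.Analysis.FunctionSpaces

variable {E : Type*} [NormedAddCommGroup E] [NormedSpace ℝ E]

/-- Discharge of the named fact `Literature.Analysis.FunctionSpaces.schwartz_minlos` (**Minlos' theorem for Schwartz
space**): for finite-dimensional `E`, every characteristic functional on `𝓢(E, ℝ)` is the
generating functional of a unique Borel probability measure on `FieldConfig E = 𝒮'(E)`. From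
`minlos_borel_holds` with `nuclearSpace_schwartzMap_holds` and `separableSpace_schwartzMap_holds`.
Minlos 1959; Gel'fand–Vilenkin IV, Ch. IV §4.2 Thm 2; Yamasaki 1985, Part A §20, Thm 20.1 (a).
[cite: GelfandVilenkinIV1964, Ch. IV §4.2 Thm. 2] [cite: Minlos1959]
[cite: Yamasaki1985, Part A §20, Thm 20.1 (a)] -/
theorem schwartz_minlos_holds : schwartz_minlos (E := E) := by
  intro _ C hC
  haveI : NuclearSpace ℝ 𝓢(E, ℝ) := nuclearSpace_schwartzMap_holds E ℝ
  haveI : SeparableSpace 𝓢(E, ℝ) := separableSpace_schwartzMap_holds E ℝ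
  simpa using minlos_borel_holds 𝓢(E, ℝ) C ((isCharacteristicFunctional_iff C).1 hC)

end Literature.Analysis.FunctionSpaces
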